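import Mathlib.Combinatorics.Hall.Basic
import Mathlib.Combinatorics.Enumerative.DoubleCounting
import Mathlib.Data.Finset.Sups
import Mathlib.Order.UpperLower.Basic
import Summits.CriticalPhenomena.PercolationContinuityZ3.Theorems.PercNearOneGluingNoHeavyLowerTailAntiBandMatching
import Summits.CriticalPhenomena.PercolationContinuityZ3.Theorems.PercNearOneGluingNoHeavyLowerTailAntiBandDegenerate

/-!
# `NoHeavyLowerTail` (crux stmt-CriticalPhenomena-4575), lane prim-ineq-gen-4 (gen 32): the anti-band inequality for a PRINCIPAL FILTER, in every cell `(n, l)`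

Support file (`--supports stmt-CriticalPhenomena-4575`; memo `run/shared/lean/prim/prim-ineq-gen-4/FINDING-COVER-MATCHING-g32.md` §4.6).
Pure finite combinatorics, no definitions, no `sorry`, standard axioms.

CONTEXT.  (AB_l)(n): for up-sets `A, B` of `Finset (Fin n)` and `O = {s | #s < l ∨ #sᶜ < l}`:  `#{s ∈ A ∩ Bᶜˢ | O s} ≤ #{s ∈ A ∩ B | O s}` (conjectured for
`2l ≤ n`; gen 20/21: it holds for `A` and every `B` as soon as the outer part `A ∩ O` admits a *covering map* `Φ` (injective, `sᶜ ⊆ Φ s`),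
`AntiBandMatching.antiBand_of_covering_map`).  Gen 31 proved the principal-filter case `A = ↑z₀` on the DIAGONAL `n = 2l` (theorem PF, via (P2) and the
level-Harris bridge).  Here: **for every `n ≥ 2l` and every `z₀`, (AB_l)(n) holds for the pair `(↑z₀, B)` and for the pair `(B, ↑z₀)`, for all up-sets `B`**
(`antiBand_principal_left`, `antiBand_principal_right`), by an EXPLICIT covering map of `↑z₀ ∩ O`:

In the coordinates `u = sᶜ ⊆ Z := z₀ᶜ` (`#Z = n − k`, `k = #z₀ ≤ l − 1 =: r`; for `k ≥ l` the pair is gen 20's degenerate case) the outer members of `↑z₀` are the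
`u ⊆ Z` with `#u ≤ r` or `#u ≥ n − r`, two of them cover `univ` iff they are DISJOINT, and a covering map is a disjointness-respecting injection `π` of this family
into itself.  Take `π u = Z \\ u` unless `r − k < #u < #Z − r`, where `π` is a "Kneser derangement" of the `#u`-subsets of `Z` (an injection `u ↦ κ u`, `#κ u = #u`,
`κ u ∩ u = ∅`, which exists by Hall's theorem since the disjointness relation on `i`-subsets of `Z` is regular of positive degree `C(#Z − i, i)` when `2i ≤ #Z`,
`exists_kneser_derangement`).  Cardinalities keep the two regimes apart, so `π` is injective (`antiBand_principal_left`, proof).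
-/

namespace Summit.CriticalPhenomena.PercolationContinuityZ3.Theorems.AntiBandPrincipal

open Finset
open scoped FinsetFamily

/-! ### A Kneser derangement from Hall's theorem -/

/-- **Kneser derangement.**  If `2i ≤ #Z`, there is a map `κ`, injective on the `i`-subsets of `Z`, sending each `i`-subset `u ⊆ Z` to an `i`-subset of `Z`
disjoint from `u`.  (Hall's marriage theorem for the disjointness relation on `Z.powersetCard i`, which is regular of degree `C(#Z − i, i) ≥ 1`.) [folklore; this work] -/
theorem exists_kneser_derangement {α : Type*} [DecidableEq α] (Z : Finset α) (i : ℕ) (hi : 2 * i ≤ #Z) :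
    ∃ κ : Finset α → Finset α, Set.InjOn κ (Z.powersetCard i) ∧
      ∀ u ∈ Z.powersetCard i, κ u ∈ Z.powersetCard i ∧ Disjoint u (κ u) := by
  classical
  set K := Z.powersetCard i with hKdef
  set d := (#Z - i).choose i with hddef
  have hdpos : 0 < d := Nat.choose_pos (by omega)
  -- the disjoint `i`-subsets of `Z` of a given `i`-subset `v ⊆ Z` are the `i`-subsets of `Z \ v`, `d` many
  have hcount : ∀ v ∈ K, #(K.filter fun u => Disjoint u v) = d := by
    intro v hv
    rw [hKdef, mem_powersetCard] at hv
    have : K.filter (fun u => Disjoint u v) = (Z \ v).powersetCard i := by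
      ext u
      rw [mem_filter, hKdef, mem_powersetCard, mem_powersetCard]
      constructor
      · rintro ⟨⟨huZ, hui⟩, huv⟩
        exact ⟨fun a ha => mem_sdiff.2 ⟨huZ ha, fun hav => disjoint_left.1 huv ha hav⟩, hui⟩
      · rintro ⟨huZv, hui⟩
        refine ⟨⟨fun a ha => (mem_sdiff.1 (huZv ha)).1, hui⟩, ?_⟩
        exact disjoint_left.2 fun a ha hav => (mem_sdiff.1 (huZv ha)).2 hav
    rw [this, card_powersetCard, card_sdiff_of_subset hv.1, hv.2]
  let t : K → Finset (Finset α) := fun u => K.filter fun v => Disjoint u.1 v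
  have hHall : ∀ S : Finset K, #S ≤ #(S.biUnion t) := by
    intro S
    set S' : Finset (Finset α) := S.map (Function.Embedding.subtype _) with hS'
    have hS'K : S' ⊆ K := fun u hu => by
      obtain ⟨a, -, rfl⟩ := mem_map.1 hu
      exact a.2
    have hcard : #S = #S' := (card_map _).symm
    -- double count disjoint pairs between `S'` and `S.biUnion t`
    have key : #S' * d ≤ #(S.biUnion t) * d := by
      refine card_mul_le_card_mul (fun u v => Disjoint u v) ?_ ?_
      · intro u hu
        -- all `d` disjoint partners of `u` lie in `S.biUnion t`
        have huK := hS'K hu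
        obtain ⟨a, ha, hau⟩ := mem_map.1 hu
        have hsub : K.filter (fun v => Disjoint v u) ⊆ (S.biUnion t).bipartiteAbove (fun u v => Disjoint u v) u := by
          intro v hv
          rw [mem_filter] at hv
          rw [mem_bipartiteAbove]
          refine ⟨mem_biUnion.2 ⟨a, ha, ?_⟩, hv.2.symm⟩
          show v ∈ K.filter fun v => Disjoint a.1 v
          rw [mem_filter]
          have : (a : Finset α) = u := hau
          rw [this]
          exact ⟨hv.1, hv.2.symm⟩
        calc d = #(K.filter fun v => Disjoint v u) := (hcount u huK).symm
          _ ≤ _ := card_le_card hsub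
      · intro v hv
        -- at most `d` members of `S'` are disjoint from `v`
        have hvK : v ∈ K := by
          obtain ⟨a, -, hav⟩ := mem_biUnion.1 hv
          exact (mem_filter.1 hav).1
        calc #(S'.bipartiteBelow (fun u v => Disjoint u v) v) ≤ #(K.filter fun u => Disjoint u v) := by
              apply card_le_card
              intro u hu
              rw [mem_bipartiteBelow] at hu
              exact mem_filter.2 ⟨hS'K hu.1, hu.2⟩
          _ = d := hcount v hvK
    rw [hcard]
    exact Nat.le_of_mul_le_mul_right key hdpos
  obtain ⟨f, hfinj, hft⟩ := (all_card_le_biUnion_card_iff_exists_injective t).1 hHall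
  refine ⟨fun u => if h : u ∈ K then f ⟨u, h⟩ else u, ?_, ?_⟩
  · intro u hu u' hu' h
    have huK : u ∈ K := hu
    have hu'K : u' ∈ K := hu'
    simp only [dif_pos huK, dif_pos hu'K] at h
    exact congrArg Subtype.val (hfinj h)
  · intro u hu
    simp only [dif_pos hu]
    have := hft ⟨u, hu⟩
    exact ⟨(mem_filter.1 this).1, (mem_filter.1 this).2⟩

/-! ### The principal filter -/

/-- **(AB_l)(n) for a principal filter on the left.**  For `1 ≤ l`, `2l ≤ n`, any `z₀ : Finset (Fin n)` and any up-set `V`: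
`#{s ∈ ↑z₀ ∩ Vᶜˢ | #s < l ∨ #sᶜ < l} ≤ #{s ∈ ↑z₀ ∩ V | #s < l ∨ #sᶜ < l}`, where `↑z₀ = {s | z₀ ⊆ s}`.
(Explicit covering map of the outer part of `↑z₀`: complementation inside `z₀ᶜ`, patched by a Kneser derangement on the middle sizes; `#z₀ ≥ l` is the degenerate
case of gen 20.) [this work; memo FINDING-COVER-MATCHING-g32 §4.6] -/
theorem antiBand_principal_left {n : ℕ} (l : ℕ) (hl : 1 ≤ l) (h2l : 2 * l ≤ n) (z₀ : Finset (Fin n))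
    (V : Finset (Finset (Fin n))) (hV : IsUpperSet (V : Set (Finset (Fin n)))) :
    #(((univ.filter fun s : Finset (Fin n) => z₀ ⊆ s) ∩ Vᶜˢ).filter fun s => #s < l ∨ #sᶜ < l)
      ≤ #(((univ.filter fun s : Finset (Fin n) => z₀ ⊆ s) ∩ V).filter fun s => #s < l ∨ #sᶜ < l) := by
  classical
  set W : Finset (Finset (Fin n)) := univ.filter fun s => z₀ ⊆ s with hWdef
  have hW : IsUpperSet (W : Set (Finset (Fin n))) := by
    intro a b hab ha
    rw [mem_coe, hWdef, mem_filter] at ha ⊢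
    exact ⟨mem_univ _, ha.2.trans hab⟩
  -- the degenerate case `l ≤ #z₀`: no member of `W` has size `< l`
  by_cases hk : l ≤ #z₀
  · refine AntiBandDegenerate.antiBand_of_no_positive l W V hW hV ?_
    intro s hs hsl
    rw [hWdef, mem_filter] at hs
    exact absurd (lt_of_lt_of_le hsl (hk.trans (card_le_card hs.2))) (lt_irrefl _)
  rw [not_le] at hk
  -- parameters
  set k := #z₀ with hkdef
  set r := l - 1 with hrdef
  set Z : Finset (Fin n) := z₀ᶜ with hZdef
  have hZcard : #Z = n - k := by rw [hZdef, card_compl, Fintype.card_fin]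
  have hkr : k ≤ r := by omega
  have hkn : k ≤ n := by
    have := card_le_univ z₀; rwa [Fintype.card_fin] at this
  -- Kneser derangements at every level `i` with `2 i ≤ #Z`
  have hκ : ∀ i : ℕ, ∃ κ : Finset (Fin n) → Finset (Fin n), 2 * i ≤ #Z →
      (Set.InjOn κ (Z.powersetCard i) ∧ ∀ u ∈ Z.powersetCard i, κ u ∈ Z.powersetCard i ∧ Disjoint u (κ u)) := by
    intro i
    by_cases h : 2 * i ≤ #Z
    · obtain ⟨κ, h1, h2⟩ := exists_kneser_derangement Z i h
      exact ⟨κ, fun _ => ⟨h1, h2⟩⟩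
    · exact ⟨id, fun h' => absurd h' h⟩
  choose κ hκ using hκ
  -- the map on complements: `π u = Z \ u` unless `r - k < #u < #Z - r` (Kneser regime)
  let kn : Finset (Fin n) → Prop := fun u => r - k < #u ∧ #u + r < #Z
  let π : Finset (Fin n) → Finset (Fin n) := fun u => if kn u then κ (#u) u else Z \ u
  -- the covering map
  let Φ : Finset (Fin n) → Finset (Fin n) := fun s => (π sᶜ)ᶜ
  -- basic facts about outer members of `W`
  have houter : ∀ s ∈ W.filter (fun s => #s < l ∨ #sᶜ < l),
      z₀ ⊆ s ∧ sᶜ ⊆ Z ∧ (#sᶜ ≤ r ∨ n - r ≤ #sᶜ) ∧ #sᶜ ≤ n - k := by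
    intro s hs
    rw [mem_filter, hWdef, mem_filter] at hs
    obtain ⟨⟨-, hzs⟩, hO⟩ := hs
    have hsc : sᶜ ⊆ Z := by rw [hZdef]; exact compl_subset_compl.2 hzs
    have h1 : #sᶜ = n - #s := by rw [card_compl, Fintype.card_fin]
    have h2 : #s ≤ n := by have := card_le_univ s; rwa [Fintype.card_fin] at this
    have h3 : k ≤ #s := card_le_card hzs
    refine ⟨hzs, hsc, ?_, by omega⟩
    rcases hO with h | h
    · right; omega
    · left; omega
  -- in the Kneser regime the level is admissible
  have hkn_level : ∀ u : Finset (Fin n), u ⊆ Z → kn u → (#u ≤ r ∨ n - r ≤ #u) → 2 * #u ≤ #Z ∧ u ∈ Z.powersetCard #u := by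
    intro u huZ hu hO
    refine ⟨?_, mem_powersetCard.2 ⟨huZ, rfl⟩⟩
    have : #u ≤ r := by
      rcases hO with h | h
      · exact h
      · exfalso
        have := hu.2; rw [hZcard] at this; omega
    have := hu.2
    omega
  -- properties of `π` on admissible `u`
  have hπ : ∀ u : Finset (Fin n), u ⊆ Z → (#u ≤ r ∨ n - r ≤ #u) →
      π u ⊆ Z ∧ Disjoint u (π u) ∧ (#(π u) ≤ r ∨ n - r ≤ #(π u)) := by
    intro u huZ hO
    by_cases hu : kn u
    · obtain ⟨h2, hmem⟩ := hkn_level u huZ hu hO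
      obtain ⟨-, hall⟩ := hκ (#u) h2
      obtain ⟨hm, hd⟩ := hall u hmem
      rw [mem_powersetCard] at hm
      simp only [π, if_pos hu]
      refine ⟨hm.1, hd, Or.inl ?_⟩
      rw [hm.2]
      rcases hO with h | h
      · exact h
      · exfalso; have := hu.2; rw [hZcard] at this; omega
    · simp only [π, if_neg hu]
      refine ⟨sdiff_subset, disjoint_sdiff, ?_⟩
      rw [card_sdiff_of_subset huZ, hZcard]
      have hu' : ¬ (r - k < #u) ∨ ¬ (#u + r < #Z) := not_and_or.1 hu
      have hule : #u ≤ n - k := by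
        have := card_le_card huZ; rwa [hZcard] at this
      rcases hu' with h | h
      · right; omega
      · rw [hZcard] at h; left; omega
  -- injectivity of `π` on admissible `u`
  have hπinj : ∀ u u' : Finset (Fin n), u ⊆ Z → (#u ≤ r ∨ n - r ≤ #u) → u' ⊆ Z → (#u' ≤ r ∨ n - r ≤ #u') →
      π u = π u' → u = u' := by
    intro u u' huZ hO hu'Z hO' h
    by_cases hu : kn u <;> by_cases hu' : kn u'
    · -- both Kneser: same level, then injectivity of `κ`
      obtain ⟨h2, hmem⟩ := hkn_level u huZ hu hO
      obtain ⟨h2', hmem'⟩ := hkn_level u' hu'Z hu' hO'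
      simp only [π, if_pos hu, if_pos hu'] at h
      have hlev : #u = #u' := by
        have a := (mem_powersetCard.1 ((hκ (#u) h2).2 u hmem).1).2
        have b := (mem_powersetCard.1 ((hκ (#u') h2').2 u' hmem').1).2
        rw [← a, ← b, h]
      rw [hlev] at h hmem
      exact (hκ (#u') h2').1 hmem hmem' h
    · -- Kneser vs complement: cardinalities differ
      exfalso
      obtain ⟨h2, hmem⟩ := hkn_level u huZ hu hO
      simp only [π, if_pos hu, if_neg hu'] at h
      have a := (mem_powersetCard.1 ((hκ (#u) h2).2 u hmem).1).2
      have b : #(Z \ u') = #Z - #u' := card_sdiff_of_subset hu'Z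
      rw [h] at a; rw [a] at b
      have hu'' : ¬ (r - k < #u') ∨ ¬ (#u' + r < #Z) := not_and_or.1 hu'
      have := hu.1; have := hu.2
      have hle : #u' ≤ #Z := card_le_card hu'Z
      rcases hu'' with c | c
      · omega
      · rcases hO' with d | d
        · omega
        · rw [hZcard] at b c hle; rw [hZcard] at this; omega
    · exfalso
      obtain ⟨h2', hmem'⟩ := hkn_level u' hu'Z hu' hO'
      simp only [π, if_neg hu, if_pos hu'] at h
      have a := (mem_powersetCard.1 ((hκ (#u') h2').2 u' hmem').1).2
      have b : #(Z \ u) = #Z - #u := card_sdiff_of_subset huZ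
      rw [← h] at a; rw [a] at b
      have huu : ¬ (r - k < #u) ∨ ¬ (#u + r < #Z) := not_and_or.1 hu
      have := hu'.1; have := hu'.2
      have hle : #u ≤ #Z := card_le_card huZ
      rcases huu with c | c
      · omega
      · rcases hO with d | d
        · omega
        · rw [hZcard] at b c hle; rw [hZcard] at this; omega
    · -- both complements inside `Z`
      simp only [π, if_neg hu, if_neg hu'] at h
      rw [← Finset.sdiff_sdiff_eq_self huZ, ← Finset.sdiff_sdiff_eq_self hu'Z, h]
  -- conclude with the covering-map criterion of gen 21
  refine AntiBandMatching.antiBand_of_covering_map l W V hV Φ ?_ ?_ ?_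
  · -- `Φ` maps the outer part of `W` into itself
    intro s hs
    obtain ⟨hzs, hsc, hO, -⟩ := houter s hs
    obtain ⟨hπZ, -, hπO⟩ := hπ sᶜ hsc hO
    rw [mem_filter, hWdef, mem_filter]
    refine ⟨⟨mem_univ _, ?_⟩, ?_⟩
    · -- `z₀ ⊆ (π sᶜ)ᶜ` since `π sᶜ ⊆ z₀ᶜ`
      show z₀ ⊆ (π sᶜ)ᶜ
      intro a ha
      rw [mem_compl]
      intro ha'
      have := hπZ ha'
      rw [hZdef, mem_compl] at this
      exact this ha
    · show #(π sᶜ)ᶜ < l ∨ #(π sᶜ)ᶜᶜ < l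
      rw [compl_compl, card_compl, Fintype.card_fin]
      have hle : #(π sᶜ) ≤ n := by have := card_le_univ (π sᶜ); rwa [Fintype.card_fin] at this
      rcases hπO with h | h
      · right; omega
      · left; omega
  · -- covering: `sᶜ ⊆ Φ s`
    intro s hs
    obtain ⟨-, hsc, hO, -⟩ := houter s hs
    obtain ⟨-, hdis, -⟩ := hπ sᶜ hsc hO
    show sᶜ ⊆ (π sᶜ)ᶜ
    intro a ha
    rw [mem_compl]
    exact fun ha' => disjoint_left.1 hdis ha ha'
  · -- injectivity
    intro s hs s' hs' h
    obtain ⟨-, hsc, hO, -⟩ := houter s hs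
    obtain ⟨-, hsc', hO', -⟩ := houter s' hs'
    have h' : π sᶜ = π s'ᶜ := compl_injective h
    have := hπinj sᶜ s'ᶜ hsc hO hsc' hO' h'
    exact compl_injective this

/-- **(AB_l)(n) for a principal filter on the right.**  For `1 ≤ l`, `2l ≤ n`, any up-set `A` and any `z₀`:
`#{s ∈ A ∩ (↑z₀)ᶜˢ | #s < l ∨ #sᶜ < l} ≤ #{s ∈ A ∩ ↑z₀ | #s < l ∨ #sᶜ < l}`, i.e. the number of outer members of `A` disjoint from `z₀` is at most the
number of outer members of `A` containing `z₀`.  (Gen 31's theorem PF gave this on the diagonal `n = 2l` only.) [this work] -/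
theorem antiBand_principal_right {n : ℕ} (l : ℕ) (hl : 1 ≤ l) (h2l : 2 * l ≤ n) (A : Finset (Finset (Fin n)))
    (hA : IsUpperSet (A : Set (Finset (Fin n)))) (z₀ : Finset (Fin n)) :
    #((A ∩ (univ.filter fun s : Finset (Fin n) => z₀ ⊆ s)ᶜˢ).filter fun s => #s < l ∨ #sᶜ < l)
      ≤ #((A ∩ (univ.filter fun s : Finset (Fin n) => z₀ ⊆ s)).filter fun s => #s < l ∨ #sᶜ < l) := by
  classical
  -- symmetry of the left side under `s ↦ sᶜ` (as in `AntiBandNoSmallCore.antiBand_symm`), then the left version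
  have hsymm : ∀ B : Finset (Finset (Fin n)),
      #((A ∩ Bᶜˢ).filter fun s => #s < l ∨ #sᶜ < l) = #((B ∩ Aᶜˢ).filter fun s => #s < l ∨ #sᶜ < l) := by
    intro B
    refine card_bij (fun s _ => sᶜ) ?_ ?_ ?_
    · intro s hs
      rw [mem_filter, mem_inter, mem_compls] at hs ⊢
      rw [compl_compl]
      exact ⟨⟨hs.1.2, hs.1.1⟩, hs.2.symm⟩
    · intro s _ t _ h
      exact compl_injective h
    · intro t ht
      refine ⟨tᶜ, ?_, compl_compl t⟩
      rw [mem_filter, mem_inter, mem_compls] at ht ⊢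
      rw [compl_compl]
      exact ⟨⟨ht.1.2, ht.1.1⟩, ht.2.symm⟩
  rw [hsymm, inter_comm A]
  exact antiBand_principal_left l hl h2l z₀ A hA

end Summit.CriticalPhenomena.PercolationContinuityZ3.Theorems.AntiBandPrincipal
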